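import Mathlib
import Summits.NavierStokesRegularity.NavierStokesRegularity.Theorems.FilamentSkeletonRssTangentSkeletonNearStraightLLowBandSymbol

/-!
# BENDING DOMINANCE BY `1/Rb²` ON THE LOW BAND, Γ-UNIFORMLY, with an EFFECTIVE threshold
# (`TangentSkeletonNearStraightL`, stmt-NavierStokesRegularity-23320; the lever of both registered mechanisms: line `child_tangent_analytic_strip_L`
# b0b56c52900dd90a PHASE 2 «bending dominance `1/Rb²` at ball scale», and the strategist's (R♯-lo) `LowBandCoupledBeamL` «by Gårding: bending symbol
# dominates `‖S_⊥‖ + ‖B‖ = O(γ/ρ²)` at every `k ≥ k_ball` … with an honest ineffective threshold» (`Cruxes/SkeletonJ1L/STRATEGY-CENSUS.md` PART III D5))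

The exact normal self-induction symbol of a straight matched-core filament displaced at wavenumber `k` is `(Γγ/4π)·(2/μ²)·𝔖(kμ)` (docstring of `liaSym`);
on the LOW band `kμ ≤ ¼` it is negative («bending») and comparable from both sides with the local-induction stiffness `(Γγ/2π)·k²·log(1/(kμ))`
(`Theorems.TangentSkeletonNearStraightLSwirlBand.liaSym_lowBand_upper/lower`, p-landed).  This file evaluates it at and above the BALL WAVENUMBER
`k_ball = 1/(Rb√(Γ log Γ))` of the crux (ball radius `Rb√(Γ log Γ)`), where `k² ∼ 1/(Rb²Γ log Γ)` is compensated by `log(1/(kμ)) ∼ ½ log Γ`: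
* `sq_mul_log_inv_mono`     — `x² log(1/x)` is monotone on `(0, ¼]` (elementary: `log(y/x) ≤ y/x − 1`, `log 4 > 1`);
* `log_ballScale_ge`        — `log(Rb√(Γ log Γ)/μ) ≥ (log Γ)/4` once `log Γ ≥ 1` and `log Γ ≥ 4 log(μ/Rb)` (the EFFECTIVE threshold);
* `ballScale_sq_mul_log_ge` — hence `x_b² log(1/x_b) ≥ μ²/(4Rb²Γ)` for `x_b = k_ball·μ = μ/(Rb√(Γ log Γ))`;
* `bending_le_lia`, `lia_le_five_mul_bending` — two-sided comparability with the local-induction stiffness on the whole low band;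
* ★ `bending_dominance`     — for EVERY `k` with `k_ball ≤ k` and `kμ ≤ ¼`:  `γ/(40π Rb²) ≤ (Γγ/4π)·(2/μ²)·(−𝔖(kμ))`, i.e. the bending symbol has the
  Γ-UNIFORM floor `γ/(40πRb²)` above the ball wavenumber — against Γ-free couplings (`½` strain, `|α| ≤ θ₀⁻¹` rotation, partner strain `O(θ₀⁻¹/ρ²)` in these
  units) this is dominance by the factor `1/Rb²` claimed by the line, for `Γ ≥ Γ₀(Rb, μ)` EXPLICIT: `log Γ ≥ max(1, 4 log(μ/Rb))` and `4μ ≤ Rb√(Γ log Γ)`;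
* `bending_ge_two_mul_coupling` — the form a Gårding/Neumann-series argument consumes: any coupling of size `s ≤ γ/(80πRb²)` is at most half the bending;
* §4 (appended): the CLOSEST-APPROACH scale `k_ρ = 1/(ρ√Γ)` — `bending_dominance_closestApproach` (`(γ/(10πρ²))·log(ρ√Γ/μ) ≤` bending for
  `k ≥ k_ρ`, `kμ ≤ ¼`), `bending_ge_two_mul_coupling_closestApproach` and the effective threshold `coupling_le_of_log_threshold`
  (`log Γ ≥ 2 log(μ/ρ) + 40πρ²s/γ ⇒ s ≤ (γ/(20πρ²)) log(ρ√Γ/μ)`): dominance over the `O(γ/ρ²)` partner strain at closest approach grows like `log(ρ√Γ/μ)`.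
HONEST FRAMING: S–M-sized real analysis (one explicit function at one explicit scale) serving the linear step of a plan about a HYPOTHETICAL filament skeleton on
the NEGATIVE side of a MODEL route; no registered stub of 23320 is closed (`stub_stripPropagation`, `stub_analyticClosingL` stay open); (R♯-lo) itself (a
whole-line band-limited operator statement) is NOT proved here — only its symbol-level input with constants; nothing here bears on Navier–Stokes regularity or
blow-up.  `--supports stmt-NavierStokesRegularity-23320`. [folklore; local-induction logarithm: Klein–Majda 1991, Majda–Bertozzi 2002 §7.1]
-/

set_option linter.dupNamespace false

noncomputable section

namespace Summit.NavierStokesRegularity.NavierStokesRegularity.Theorems.TangentSkeletonNearStraightLBendingDominance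

open Real
open Summit.NavierStokesRegularity.NavierStokesRegularity.Theorems.AnalyticStripLiaSymbol
open Summit.NavierStokesRegularity.NavierStokesRegularity.Theorems.TangentSkeletonNearStraightLSwirlBand
  (liaSym_lowBand_upper liaSym_lowBand_lower)

/-! ## §1 Elementary monotonicity and the ball-scale logarithm -/

/-- **`x ↦ x² log(1/x)` is monotone on `(0, ¼]`** (indeed on `(0, e^{-1/2}]`; the quarter suffices here):
`log(1/x) = log(1/y) + log(y/x) ≤ log(1/y) + y/x − 1` and `log(1/y) ≥ log 4 > 1`. [folklore] -/
theorem sq_mul_log_inv_mono {x y : ℝ} (hx : 0 < x) (hxy : x ≤ y) (hy4 : y ≤ 1 / 4) :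
    x ^ 2 * Real.log (1 / x) ≤ y ^ 2 * Real.log (1 / y) := by
  have hy : 0 < y := lt_of_lt_of_le hx hxy
  have h1 : Real.log (1 / x) = Real.log (1 / y) + Real.log (y / x) := by
    rw [← Real.log_mul (by positivity) (by positivity)]
    congr 1
    field_simp
  have h2 : Real.log (y / x) ≤ y / x - 1 := Real.log_le_sub_one_of_pos (by positivity)
  have hly : Real.log 4 ≤ Real.log (1 / y) := by
    apply Real.log_le_log (by norm_num)
    rw [le_one_div (by norm_num) hy]
    linarith
  have hl4 : (1 : ℝ) < Real.log 4 := by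
    -- (`Literature.NumberTheory.LFunctions.one_lt_log_four` states the same; re-derived in two lines to keep the import cone small)
    have hl2a : (0.6931471803 : ℝ) < Real.log 2 := Real.log_two_gt_d9
    have h : Real.log 4 = 2 * Real.log 2 := by
      rw [show (4:ℝ) = 2 ^ 2 by norm_num, Real.log_pow]; norm_num
    rw [h]; linarith
  have hl1 : 1 ≤ Real.log (1 / y) := le_trans hl4.le hly
  have hx2 : 0 ≤ x ^ 2 := sq_nonneg x
  have h3 : x ^ 2 * Real.log (1 / x) ≤ x ^ 2 * Real.log (1 / y) + (x * y - x ^ 2) := by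
    have hxe : x ^ 2 * (y / x - 1) = x * y - x ^ 2 := by
      field_simp
    rw [h1, mul_add, ← hxe]
    have := mul_le_mul_of_nonneg_left h2 hx2
    linarith
  have hyx : 0 ≤ y ^ 2 - x ^ 2 := by nlinarith
  have h4 : x * y - x ^ 2 ≤ (y ^ 2 - x ^ 2) * Real.log (1 / y) := by
    have := mul_le_mul_of_nonneg_left hl1 hyx
    nlinarith
  nlinarith

/-- **The ball-scale logarithm is at least a quarter of `log Γ`** (effective threshold): for `Γ ≥ 1` with `log Γ ≥ 1` and `4 log(μ/Rb) ≤ log Γ`,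
`(log Γ)/4 ≤ log(Rb√(Γ log Γ)/μ)` (`= log(Rb/μ) + ½ log Γ + ½ log log Γ`, and `log log Γ ≥ 0`). [folklore] -/
theorem log_ballScale_ge {Rb μ Γ : ℝ} (hRb : 0 < Rb) (hμ : 0 < μ) (hΓ1 : 1 ≤ Γ) (hlog : 1 ≤ Real.log Γ)
    (h4 : 4 * Real.log (μ / Rb) ≤ Real.log Γ) :
    Real.log Γ / 4 ≤ Real.log (Rb * √(Γ * Real.log Γ) / μ) := by
  have hΓ : 0 < Γ := by linarith
  have hGL : 0 < Γ * Real.log Γ := by positivity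
  have hsq : 0 < √(Γ * Real.log Γ) := Real.sqrt_pos.mpr hGL
  have hdecomp : Real.log (Rb * √(Γ * Real.log Γ) / μ) =
      Real.log Rb - Real.log μ + (Real.log Γ + Real.log (Real.log Γ)) / 2 := by
    rw [Real.log_div (by positivity) hμ.ne', Real.log_mul hRb.ne' hsq.ne', Real.log_sqrt hGL.le,
      Real.log_mul hΓ.ne' (by linarith : Real.log Γ ≠ 0)]
    ring
  have hll : 0 ≤ Real.log (Real.log Γ) := Real.log_nonneg hlog
  have hμRb : Real.log (μ / Rb) = Real.log μ - Real.log Rb := Real.log_div hμ.ne' hRb.ne'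
  rw [hdecomp]
  rw [hμRb] at h4
  linarith

/-- **The local-induction stiffness at the ball wavenumber, from below**: with `x_b = μ/(Rb√(Γ log Γ))` (`= k_ball·μ`),
`μ²/(4Rb²Γ) ≤ x_b²·log(1/x_b)` under the threshold of `log_ballScale_ge`. [folklore] -/
theorem ballScale_sq_mul_log_ge {Rb μ Γ : ℝ} (hRb : 0 < Rb) (hμ : 0 < μ) (hΓ1 : 1 ≤ Γ) (hlog : 1 ≤ Real.log Γ)
    (h4 : 4 * Real.log (μ / Rb) ≤ Real.log Γ) :
    μ ^ 2 / (4 * Rb ^ 2 * Γ) ≤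
      (μ / (Rb * √(Γ * Real.log Γ))) ^ 2 * Real.log (1 / (μ / (Rb * √(Γ * Real.log Γ)))) := by
  have hΓ : 0 < Γ := by linarith
  have hGL : 0 < Γ * Real.log Γ := by positivity
  have hsq : 0 < √(Γ * Real.log Γ) := Real.sqrt_pos.mpr hGL
  have hlb := log_ballScale_ge hRb hμ hΓ1 hlog h4
  have hinv : 1 / (μ / (Rb * √(Γ * Real.log Γ))) = Rb * √(Γ * Real.log Γ) / μ := by
    rw [one_div_div]
  rw [hinv]
  have hxsq : (μ / (Rb * √(Γ * Real.log Γ))) ^ 2 = μ ^ 2 / (Rb ^ 2 * (Γ * Real.log Γ)) := by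
    rw [div_pow, mul_pow, Real.sq_sqrt hGL.le]
  rw [hxsq]
  have hpos : 0 < μ ^ 2 / (Rb ^ 2 * (Γ * Real.log Γ)) := by positivity
  -- μ²/(4Rb²Γ) = (μ²/(Rb²Γ log Γ)) · (log Γ/4)
  have hid : μ ^ 2 / (4 * Rb ^ 2 * Γ) = μ ^ 2 / (Rb ^ 2 * (Γ * Real.log Γ)) * (Real.log Γ / 4) := by
    field_simp
  rw [hid]
  exact mul_le_mul_of_nonneg_left hlb hpos.le

/-! ## §2 Two-sided comparability with the local-induction stiffness on the low band -/

/-- **Bending ≤ local-induction stiffness** on the low band: for `0 < kμ ≤ ¼` and `Γγ ≥ 0`,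
`(Γγ/4π)·(2/μ²)·(−𝔖(kμ)) ≤ (Γγ/2π)·k²·log(1/(kμ))` (lower window `−x² log(1/x) ≤ 𝔖(x)`). [folklore] -/
theorem bending_le_lia {Γ γ μ k : ℝ} (hΓγ : 0 ≤ Γ * γ) (hμ : 0 < μ) (hk : 0 < k) (hkμ : k * μ ≤ 1 / 4) :
    Γ * γ / (4 * π) * (2 / μ ^ 2) * (-liaSym (k * μ)) ≤ Γ * γ / (2 * π) * (k ^ 2 * Real.log (1 / (k * μ))) := by
  have hx : 0 < k * μ := by positivity
  have hwin := liaSym_lowBand_lower hx hkμ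
  have hcoef : 0 ≤ Γ * γ / (4 * π) * (2 / μ ^ 2) := by positivity
  have h1 : Γ * γ / (4 * π) * (2 / μ ^ 2) * (-liaSym (k * μ)) ≤
      Γ * γ / (4 * π) * (2 / μ ^ 2) * ((k * μ) ^ 2 * Real.log (1 / (k * μ))) :=
    mul_le_mul_of_nonneg_left (by linarith) hcoef
  have h2 : Γ * γ / (4 * π) * (2 / μ ^ 2) * ((k * μ) ^ 2 * Real.log (1 / (k * μ))) =
      Γ * γ / (2 * π) * (k ^ 2 * Real.log (1 / (k * μ))) := by
    field_simp
    ring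
  linarith [h2.le, h2.ge]

/-- **Local-induction stiffness ≤ 5 × bending** on the low band: for `0 < kμ ≤ ¼` and `Γγ ≥ 0`,
`(Γγ/2π)·k²·log(1/(kμ)) ≤ 5·(Γγ/4π)·(2/μ²)·(−𝔖(kμ))` (upper window `𝔖(x) ≤ −(x²/5) log(1/x)`). [folklore] -/
theorem lia_le_five_mul_bending {Γ γ μ k : ℝ} (hΓγ : 0 ≤ Γ * γ) (hμ : 0 < μ) (hk : 0 < k) (hkμ : k * μ ≤ 1 / 4) :
    Γ * γ / (2 * π) * (k ^ 2 * Real.log (1 / (k * μ))) ≤ 5 * (Γ * γ / (4 * π) * (2 / μ ^ 2) * (-liaSym (k * μ))) := by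
  have hx : 0 < k * μ := by positivity
  have hwin := liaSym_lowBand_upper hx hkμ
  have hcoef : 0 ≤ Γ * γ / (4 * π) * (2 / μ ^ 2) := by positivity
  have h1 : Γ * γ / (4 * π) * (2 / μ ^ 2) * ((k * μ) ^ 2 / 5 * Real.log (1 / (k * μ))) ≤
      Γ * γ / (4 * π) * (2 / μ ^ 2) * (-liaSym (k * μ)) :=
    mul_le_mul_of_nonneg_left (by linarith) hcoef
  have h2 : 5 * (Γ * γ / (4 * π) * (2 / μ ^ 2) * ((k * μ) ^ 2 / 5 * Real.log (1 / (k * μ)))) =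
      Γ * γ / (2 * π) * (k ^ 2 * Real.log (1 / (k * μ))) := by
    field_simp
    ring
  linarith [h2.le, h2.ge]

/-! ## §3 The Γ-uniform floor above the ball wavenumber -/

/-- ★ **BENDING DOMINANCE BY `1/Rb²`, Γ-UNIFORMLY, ABOVE THE BALL WAVENUMBER.**  Let `γ, μ, Rb > 0`, `Γ ≥ 1` with `log Γ ≥ 1` and `4 log(μ/Rb) ≤ log Γ`.
For every wavenumber `k` with `1/(Rb√(Γ log Γ)) ≤ k` (at or above the ball wavenumber) and `kμ ≤ ¼` (low band):
`γ/(40π Rb²) ≤ (Γγ/4π)·(2/μ²)·(−𝔖(kμ))`.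
Proof: upper window `−𝔖(x) ≥ (x²/5) log(1/x)`, monotonicity of `x² log(1/x)` down to `x_b = k_ball μ`, and `x_b² log(1/x_b) ≥ μ²/(4Rb²Γ)`. [folklore] -/
theorem bending_dominance {γ μ Rb Γ k : ℝ} (hγ : 0 < γ) (hμ : 0 < μ) (hRb : 0 < Rb) (hΓ1 : 1 ≤ Γ) (hlog : 1 ≤ Real.log Γ)
    (h4 : 4 * Real.log (μ / Rb) ≤ Real.log Γ)
    (hk : 1 / (Rb * √(Γ * Real.log Γ)) ≤ k) (hkμ : k * μ ≤ 1 / 4) :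
    γ / (40 * π * Rb ^ 2) ≤ Γ * γ / (4 * π) * (2 / μ ^ 2) * (-liaSym (k * μ)) := by
  have hΓ : 0 < Γ := by linarith
  have hGL : 0 < Γ * Real.log Γ := by positivity
  have hsq : 0 < √(Γ * Real.log Γ) := Real.sqrt_pos.mpr hGL
  have hkb : 0 < 1 / (Rb * √(Γ * Real.log Γ)) := by positivity
  have hkpos : 0 < k := lt_of_lt_of_le hkb hk
  have hx : 0 < k * μ := by positivity
  -- the ball-scale point `x_b = k_ball μ ≤ k μ`
  set xb : ℝ := μ / (Rb * √(Γ * Real.log Γ)) with hxb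
  have hxb_pos : 0 < xb := by positivity
  have hxb_le : xb ≤ k * μ := by
    have : xb = 1 / (Rb * √(Γ * Real.log Γ)) * μ := by rw [hxb]; ring
    rw [this]
    exact mul_le_mul_of_nonneg_right hk hμ.le
  -- chain: μ²/(4Rb²Γ) ≤ xb² log(1/xb) ≤ (kμ)² log(1/(kμ)) ≤ 5·(−𝔖(kμ))
  have h1 := ballScale_sq_mul_log_ge hRb hμ hΓ1 hlog h4
  have h2 := sq_mul_log_inv_mono hxb_pos hxb_le hkμ
  have h3 := liaSym_lowBand_upper hx hkμ
  have hchain : μ ^ 2 / (4 * Rb ^ 2 * Γ) ≤ 5 * (-liaSym (k * μ)) := by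
    have : (k * μ) ^ 2 * Real.log (1 / (k * μ)) ≤ 5 * (-liaSym (k * μ)) := by linarith
    exact le_trans (le_trans h1 h2) this
  -- multiply by the positive coefficient `(Γγ/4π)(2/μ²)/5`
  have hcoef : 0 < Γ * γ / (4 * π) * (2 / μ ^ 2) := by positivity
  have hid : γ / (40 * π * Rb ^ 2) = Γ * γ / (4 * π) * (2 / μ ^ 2) * (μ ^ 2 / (4 * Rb ^ 2 * Γ) / 5) := by
    field_simp
    ring
  rw [hid]
  apply mul_le_mul_of_nonneg_left _ hcoef.le
  linarith

/-- **The form a Gårding / Neumann-series step consumes**: under the hypotheses of `bending_dominance`, every Γ-free coupling of size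
`s ≤ γ/(80π Rb²)` (strain, frame rotation and partner strain are of this kind for `Rb` small) is at most HALF the bending symbol at every low-band
wavenumber above the ball wavenumber. [folklore] -/
theorem bending_ge_two_mul_coupling {γ μ Rb Γ k s : ℝ} (hγ : 0 < γ) (hμ : 0 < μ) (hRb : 0 < Rb) (hΓ1 : 1 ≤ Γ)
    (hlog : 1 ≤ Real.log Γ) (h4 : 4 * Real.log (μ / Rb) ≤ Real.log Γ)
    (hk : 1 / (Rb * √(Γ * Real.log Γ)) ≤ k) (hkμ : k * μ ≤ 1 / 4) (hs : s ≤ γ / (80 * π * Rb ^ 2)) :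
    2 * s ≤ Γ * γ / (4 * π) * (2 / μ ^ 2) * (-liaSym (k * μ)) := by
  have h := bending_dominance hγ hμ hRb hΓ1 hlog h4 hk hkμ
  have hid : γ / (40 * π * Rb ^ 2) = 2 * (γ / (80 * π * Rb ^ 2)) := by
    field_simp
    ring
  linarith

/-! ## §4 (appended 2026-08-31, same hand) The CLOSEST-APPROACH scale `k_ρ = 1/(ρ√Γ)`: dominance `∝ log(ρ√Γ/μ)` with an effective Γ-threshold

At the closest approach of two filaments (distance `ρ√Γ`, a parameter window of length `≍ ρ√Γ`) the partner strain is `O(γ/ρ²)` and is NOT dominated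
Γ-uniformly by the ball-scale floor `γ/(40πRb²)` of §3; the relevant wavenumber there is `k_ρ = 1/(ρ√Γ)`, at which the bending symbol is
`≥ (γ/(10πρ²))·log(ρ√Γ/μ)` — the ratio to the `O(γ/ρ²)` coupling grows like `log(ρ√Γ/μ)` (the strategist's N9: «degeneration needs cores at distance
`O(μ)`», excluded by the separation clause), so dominance by a factor `2` holds for `log Γ ≥ 2 log(μ/ρ) + 40πρ²s/γ`: the «honest ineffective threshold» of
(R♯-lo) made effective at the symbol level. -/

/-- **The local-induction stiffness at the closest-approach wavenumber**: with `x_ρ = μ/(ρ√Γ)` (`= k_ρ·μ`), for `Γ > 0`,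
`x_ρ²·log(1/x_ρ) = (μ²/(ρ²Γ))·log(ρ√Γ/μ)`. [folklore] -/
theorem closestApproach_sq_mul_log_eq (ρ μ : ℝ) {Γ : ℝ} (hΓ : 0 < Γ) :
    (μ / (ρ * √Γ)) ^ 2 * Real.log (1 / (μ / (ρ * √Γ))) = μ ^ 2 / (ρ ^ 2 * Γ) * Real.log (ρ * √Γ / μ) := by
  rw [one_div_div, div_pow, mul_pow, Real.sq_sqrt hΓ.le]

/-- ★ **BENDING DOMINANCE AT THE CLOSEST-APPROACH SCALE.**  Let `γ, μ, ρ, Γ > 0`.  For every wavenumber `k` with `1/(ρ√Γ) ≤ k` and `kμ ≤ ¼`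
(so in particular `4μ ≤ ρ√Γ`: cores thinner than a quarter of the separation):  `(γ/(10π ρ²))·log(ρ√Γ/μ) ≤ (Γγ/4π)·(2/μ²)·(−𝔖(kμ))`. [folklore] -/
theorem bending_dominance_closestApproach {γ μ ρ Γ k : ℝ} (hγ : 0 < γ) (hμ : 0 < μ) (hρ : 0 < ρ) (hΓ : 0 < Γ)
    (hk : 1 / (ρ * √Γ) ≤ k) (hkμ : k * μ ≤ 1 / 4) :
    γ / (10 * π * ρ ^ 2) * Real.log (ρ * √Γ / μ) ≤ Γ * γ / (4 * π) * (2 / μ ^ 2) * (-liaSym (k * μ)) := by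
  have hsq : 0 < √Γ := Real.sqrt_pos.mpr hΓ
  have hkb : 0 < 1 / (ρ * √Γ) := by positivity
  have hkpos : 0 < k := lt_of_lt_of_le hkb hk
  have hx : 0 < k * μ := by positivity
  set xr : ℝ := μ / (ρ * √Γ) with hxr
  have hxr_pos : 0 < xr := by positivity
  have hxr_le : xr ≤ k * μ := by
    have : xr = 1 / (ρ * √Γ) * μ := by rw [hxr]; ring
    rw [this]
    exact mul_le_mul_of_nonneg_right hk hμ.le
  have h1 := closestApproach_sq_mul_log_eq ρ μ hΓ
  have h2 := sq_mul_log_inv_mono hxr_pos hxr_le hkμ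
  have h3 := liaSym_lowBand_upper hx hkμ
  have hchain : μ ^ 2 / (ρ ^ 2 * Γ) * Real.log (ρ * √Γ / μ) ≤ 5 * (-liaSym (k * μ)) := by
    have : (k * μ) ^ 2 * Real.log (1 / (k * μ)) ≤ 5 * (-liaSym (k * μ)) := by linarith
    rw [← h1]
    exact le_trans h2 this
  have hcoef : 0 < Γ * γ / (4 * π) * (2 / μ ^ 2) := by positivity
  have hid : γ / (10 * π * ρ ^ 2) * Real.log (ρ * √Γ / μ) =
      Γ * γ / (4 * π) * (2 / μ ^ 2) * (μ ^ 2 / (ρ ^ 2 * Γ) * Real.log (ρ * √Γ / μ) / 5) := by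
    field_simp
    ring
  rw [hid]
  apply mul_le_mul_of_nonneg_left _ hcoef.le
  linarith

/-- **Effective Γ-threshold for dominance over an `O(γ/ρ²)`-type coupling at closest approach**: if `s ≤ (γ/(20πρ²))·log(ρ√Γ/μ)` — equivalently
`log(ρ√Γ/μ) ≥ 20πρ²s/γ`, i.e. `log Γ ≥ 2 log(μ/ρ) + 40πρ²s/γ` — then `2s ≤` the bending symbol at every `k ≥ 1/(ρ√Γ)` of the low band. [folklore] -/
theorem bending_ge_two_mul_coupling_closestApproach {γ μ ρ Γ k s : ℝ} (hγ : 0 < γ) (hμ : 0 < μ) (hρ : 0 < ρ) (hΓ : 0 < Γ)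
    (hk : 1 / (ρ * √Γ) ≤ k) (hkμ : k * μ ≤ 1 / 4)
    (hs : s ≤ γ / (20 * π * ρ ^ 2) * Real.log (ρ * √Γ / μ)) :
    2 * s ≤ Γ * γ / (4 * π) * (2 / μ ^ 2) * (-liaSym (k * μ)) := by
  have h := bending_dominance_closestApproach hγ hμ hρ hΓ hk hkμ
  have hid : γ / (10 * π * ρ ^ 2) * Real.log (ρ * √Γ / μ) = 2 * (γ / (20 * π * ρ ^ 2) * Real.log (ρ * √Γ / μ)) := by
    field_simp
    ring
  linarith

/-- The threshold in `log Γ` form: for `Γ > 0`, `log(ρ√Γ/μ) = (log Γ)/2 − log(μ/ρ)`, so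
`2 log(μ/ρ) + 40πρ²s/γ ≤ log Γ` gives `s ≤ (γ/(20πρ²))·log(ρ√Γ/μ)`. [folklore] -/
theorem coupling_le_of_log_threshold {γ μ ρ Γ s : ℝ} (hγ : 0 < γ) (hμ : 0 < μ) (hρ : 0 < ρ) (hΓ : 0 < Γ)
    (hth : 2 * Real.log (μ / ρ) + 40 * π * ρ ^ 2 * s / γ ≤ Real.log Γ) :
    s ≤ γ / (20 * π * ρ ^ 2) * Real.log (ρ * √Γ / μ) := by
  have hsq : 0 < √Γ := Real.sqrt_pos.mpr hΓ
  have hlog : Real.log (ρ * √Γ / μ) = Real.log Γ / 2 - Real.log (μ / ρ) := by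
    rw [Real.log_div (by positivity) hμ.ne', Real.log_mul hρ.ne' hsq.ne', Real.log_sqrt hΓ.le,
      Real.log_div hμ.ne' hρ.ne']
    ring
  rw [hlog]
  have hc : 0 < γ / (20 * π * ρ ^ 2) := by positivity
  -- s ≤ c·(log Γ/2 − log(μ/ρ))  ⟸  40πρ² s/γ ≤ log Γ − 2 log(μ/ρ)
  have key : 40 * π * ρ ^ 2 * s / γ ≤ Real.log Γ - 2 * Real.log (μ / ρ) := by linarith
  have hid : γ / (20 * π * ρ ^ 2) * (Real.log Γ / 2 - Real.log (μ / ρ)) =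
      (Real.log Γ - 2 * Real.log (μ / ρ)) * (γ / (40 * π * ρ ^ 2)) := by
    field_simp
    ring
  rw [hid]
  have hs' : s = (40 * π * ρ ^ 2 * s / γ) * (γ / (40 * π * ρ ^ 2)) := by
    field_simp
  rw [hs']
  exact mul_le_mul_of_nonneg_right key (by positivity)

end Summit.NavierStokesRegularity.NavierStokesRegularity.Theorems.TangentSkeletonNearStraightLBendingDominance

end
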